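import Literature.Topology.FourManifolds.PlumbingHomology
import Literature.Topology.FourManifolds.SphereProductThomFundamentalClass
import Literature.Topology.FourManifolds.ClosedModelRelOrientation
import Literature.AlgebraicTopology.SingularHomology.OnePointCollapse
import Literature.AlgebraicTopology.FundamentalGroupoid.SimplyConnectedComplDiscrete
import HarnessLib

/-!
# The Thom collapses of the closed model of `M(4m)` onto the Thom spaces of the tubes

Topic `Literature/Topology/FourManifolds`; part of the computation of the intersection form of
Kosinski's plumbing `M(4m)` (A. Kosinski, *Differential Manifolds* (1993), VI.12, (12.3)–(12.4)).
For a tube parameter `c'` with `c ≤ c'`, `1 - c'² < ε` the whole thinner tube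
`N_{c'}° = {⟪p, q⟫ > c'}` of the `v`-th copy of `Sᵏ × Sᵏ` lies in the interior `{ρ < ε}` of
`M(4m) = {ρ ≤ ε}`, so it embeds openly in the closed model `M̂ = M(4m)/∂M(4m)`
(`Plumbing.tubeEmb`); collapsing its complement gives

* `Plumbing.collapseV v : C(M̂, N̂_{c'})` — the **Thom collapse of `M̂` onto the Thom space of the
  `v`-th tube** (tree `OnePoint.collapseCM`), equal to the model collapse `SphereProd.tubeCollapse`
  on the tube (`collapseV_tubeEmb`) and to `∞` off it;
* `Plumbing.coreS v : C(Sᵏ, M̂)` — the core spheres, with **`collapseV v ∘ coreS v = ĉ ∘ diag`**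
  and, for an edge `{v, w}`, **`collapseV v ∘ coreS w = ĉ ∘ slice_{e_{vw}}`** (the core of `w`
  meets the `v`-th tube in the fibre disc over the crossing point: `plumbMap e (p, p) = (e, p)`);
* `Plumbing.isGenerator_toLocal_map_collapseV` — the pushed fundamental class `(collapseV v)_* ẑ`
  restricts to generators at all finite points of the Thom space
  (`OnePoint.isIso_map_collapse_local`, `isGenerator_toLocal_closedModelClass_of_mem_interior`);
* `Plumbing.map_compl_coreSet_eq_zero` — a class pulled back from the Thom space which vanishes off
  the image of the diagonal vanishes off the core sphere;
* `Plumbing.exists_eq_smul_coreT` — `Hₖ` of the tube is generated by the core class.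

Everything is proved; no named facts (D-0026).

## References

* A. Kosinski, *Differential Manifolds*, Academic Press 1993, VI.12. [Kosinski1993]
* J. Milnor, J. Stasheff, *Characteristic classes*, Princeton UP 1974, §18. [MilnorStasheff1974]
-/

open scoped Manifold ContDiff Topology RealInnerProductSpace
open Set Function Module Filter Metric Topology CategoryTheory
open Literature.AlgebraicTopology.SingularHomology

noncomputable section

namespace Literature.Topology.FourManifolds

namespace Plumbing

/-- Local notation: `𝔼 n` is the model Euclidean space `EuclideanSpace ℝ (Fin n)`. -/
local notation "𝔼 " n:arg => EuclideanSpace ℝ (Fin n)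

/-- Local notation: `𝕊 n` is the unit sphere in `EuclideanSpace ℝ (Fin (n + 1))`. -/
local notation "𝕊 " n:arg => (Metric.sphere (0 : EuclideanSpace ℝ (Fin (n + 1))) 1)

variable {k : ℕ} {c : ℝ} {n : ℕ} (hk : 2 ≤ k) (hc : IsParam c) (hkn : k + k = n + 1)
  {ε : ℝ} (hε : 0 < ε) (hε' : ε ≤ epsMax c)
  {c' : ℝ} (hc' : |c'| < 1) (hcc' : c ≤ c') (hc'ε : 1 - c' ^ 2 < ε)

/-! ### §1 The thinner tube inside the interior of `M(4m)` -/

/-- The inclusion of the thinner tube `N_{c'}° ⊆ N_c°`. [folklore] -/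
def inclTb (hcc' : c ≤ c') (y : Tb k c') : Tb k c := ⟨y.1, lt_of_le_of_lt hcc' y.2⟩

/-- `continuous_inclTb` (continuous inclTb). [folklore] -/
theorem continuous_inclTb : Continuous (inclTb (k := k) hcc') :=
  Continuous.subtype_mk continuous_subtype_val _

/-- `coe_inclTb` (coe inclTb). [folklore] -/
@[simp] theorem coe_inclTb (y : Tb k c') : (inclTb hcc' y : (𝕊 k) × (𝕊 k)) = (y : (𝕊 k) × (𝕊 k)) := rfl

include hc hc'ε in
/-- **The thinner tube lies in `{ρ < ε}`**: `ρ ≤ b < 1 - c'² < ε`. [folklore] -/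
theorem rho_ι_inclTb_lt (v : Fin 8) (y : Tb k c') : rho hk hc hkn (ι hk hc hkn v (inclTb hcc' y)) < ε := by
  rw [rho_ι]
  have h1 := rhoHat_le_bFn hc v (inclTb hcc' y : (𝕊 k) × (𝕊 k))
  have h2 : bFn (inclTb hcc' y : (𝕊 k) × (𝕊 k)) < 1 - c' ^ 2 := by
    rw [coe_inclTb, bFn_apply]
    have hy : c' < fibHt (y : (𝕊 k) × (𝕊 k)) := y.2
    have h0 : 0 ≤ c' := hc.nonneg.trans hcc'
    nlinarith
  linarith

/-- The null-cobordism `M(4m)` (abbreviation). [folklore] -/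
abbrev nbW : NullCobordism n (Wc.bd hk hc hkn hε).carrier := Wc.nullCobordism hk hc hkn hε hε'

/-- A point of the plumbed manifold with `ρ < ε`, as a point of the interior of `M(4m)`. [folklore] -/
def intPt (p : PV k c hk hc hkn) (hp : rho hk hc hkn p < ε) : ManifoldInterior n (nbW hk hc hkn hε hε').W :=
  ⟨(⟨p, le_of_lt hp⟩ : Wc hk hc hkn hε), (RegularSublevel.isInteriorPoint_iff _ _).2 hp⟩

/-- `intPt` is continuous on `{ρ < ε}`. [folklore] -/
theorem continuous_intPt {S : Type*} [TopologicalSpace S] {f : S → PV k c hk hc hkn} (hf : Continuous f)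
    (h : ∀ s, rho hk hc hkn (f s) < ε) : Continuous fun s => intPt hk hc hkn hε hε' (f s) (h s) := by
  unfold intPt ManifoldInterior
  refine Continuous.subtype_mk ?_ _
  change Continuous fun s => (⟨f s, le_of_lt (h s)⟩ : Wc hk hc hkn hε)
  exact Continuous.subtype_mk hf _

/-- The underlying point of the plumbed manifold of an interior point of `M(4m)`. [folklore] -/
def ptPV (x : ManifoldInterior n (nbW hk hc hkn hε hε').W) : PV k c hk hc hkn := (x.1 : Wc hk hc hkn hε).1

/-- `ptPV_intPt` (ptPV intPt). [folklore] -/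
@[simp] theorem ptPV_intPt (p : PV k c hk hc hkn) (hp : rho hk hc hkn p < ε) :
    ptPV hk hc hkn hε hε' (intPt hk hc hkn hε hε' p hp) = p := rfl

/-- `rho_ptPV_lt` (rho ptPV lt). [folklore] -/
theorem rho_ptPV_lt (x : ManifoldInterior n (nbW hk hc hkn hε hε').W) : rho hk hc hkn (ptPV hk hc hkn hε hε' x) < ε :=
  (RegularSublevel.isInteriorPoint_iff _ (x.1 : Wc hk hc hkn hε)).1 x.2

/-- `intPt_ptPV` (intPt ptPV). [folklore] -/
@[simp] theorem intPt_ptPV (x : ManifoldInterior n (nbW hk hc hkn hε hε').W) :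
    intPt hk hc hkn hε hε' (ptPV hk hc hkn hε hε' x) (rho_ptPV_lt hk hc hkn hε hε' x) = x := rfl

/-- `continuous_ptPV` (continuous ptPV). [folklore] -/
theorem continuous_ptPV : Continuous (ptPV hk hc hkn hε hε') :=
  continuous_subtype_val.comp continuous_subtype_val

/-- `intPt` is injective. [folklore] -/
theorem intPt_injective {p q : PV k c hk hc hkn} {hp : rho hk hc hkn p < ε} {hq : rho hk hc hkn q < ε}
    (h : intPt hk hc hkn hε hε' p hp = intPt hk hc hkn hε hε' q hq) : p = q := by
  have := congrArg (ptPV hk hc hkn hε hε') h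
  simpa using this

/-- The map `{ρ < ε} → interior` is an open embedding (indeed a homeomorphism). [folklore] -/
theorem isOpenEmbedding_intPt :
    IsOpenEmbedding (fun p : ↥{p : PV k c hk hc hkn | rho hk hc hkn p < ε} => intPt hk hc hkn hε hε' p.1 p.2) := by
  -- it is a homeomorphism onto the interior
  let e : ↥{p : PV k c hk hc hkn | rho hk hc hkn p < ε} ≃ₜ ManifoldInterior n (nbW hk hc hkn hε hε').W :=
    { toFun := fun p => intPt hk hc hkn hε hε' p.1 p.2
      invFun := fun x => ⟨ptPV hk hc hkn hε hε' x, rho_ptPV_lt hk hc hkn hε hε' x⟩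
      left_inv := fun _ => rfl
      right_inv := fun _ => rfl
      continuous_toFun := continuous_intPt hk hc hkn hε hε' continuous_subtype_val _
      continuous_invFun := Continuous.subtype_mk (continuous_ptPV hk hc hkn hε hε') _ }
  exact e.isOpenEmbedding

/-! ### §2 The tube embedding and the collapse -/

section Tube

include hc'ε

/-- **The embedding of the thinner `v`-th tube into the closed model `M̂`.** [folklore] -/
def tubeEmb (v : Fin 8) (y : Tb k c') : ClosedModel n (nbW hk hc hkn hε hε').W :=
  ClosedModel.ofInterior (intPt hk hc hkn hε hε' (ι hk hc hkn v (inclTb hcc' y)) (rho_ι_inclTb_lt hk hc hkn hcc' hc'ε v y))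

/-- `tubeEmb` is an open embedding. [folklore] -/
theorem isOpenEmbedding_tubeEmb (v : Fin 8) : IsOpenEmbedding (tubeEmb hk hc hkn hε hε' hcc' hc'ε v) := by
  -- `Tb c' → {ρ < ε}` is an open embedding
  have h0 : IsOpenEmbedding (fun y : Tb k c' => ι hk hc hkn v (inclTb hcc' y)) := by
    refine (isOpenEmbedding_ι hk hc hkn v).comp ?_
    refine IsOpenEmbedding.of_continuous_injective_isOpenMap (continuous_inclTb hcc')
      (fun y y' h => Subtype.ext (congrArg (fun x : Tb k c => (x : (𝕊 k) × (𝕊 k))) h)) ?_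
    intro U hU
    have : inclTb hcc' '' U = Subtype.val ⁻¹' (Subtype.val '' U) := by
      ext x
      simp only [mem_image, mem_preimage]
      constructor
      · rintro ⟨y, hy, rfl⟩; exact ⟨y, hy, rfl⟩
      · rintro ⟨y, hy, hyx⟩; exact ⟨y, hy, Subtype.ext hyx⟩
    rw [this]
    exact ((Tb k c').isOpen.isOpenMap_subtype_val U hU).preimage continuous_subtype_val
  have h1 : IsOpenEmbedding (fun y : Tb k c' => (⟨ι hk hc hkn v (inclTb hcc' y), rho_ι_inclTb_lt hk hc hkn hcc' hc'ε v y⟩ :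
      ↥{p : PV k c hk hc hkn | rho hk hc hkn p < ε})) :=
    Literature.AlgebraicTopology.FundamentalGroupoid.isOpenEmbedding_codRestrict
      (f := fun y : Tb k c' => ι hk hc hkn v (inclTb hcc' y)) h0
      (fun y => rho_ι_inclTb_lt hk hc hkn hcc' hc'ε v y)
  exact OnePoint.isOpenEmbedding_coe.comp ((isOpenEmbedding_intPt hk hc hkn hε hε').comp h1)

/-- **The tube set** `O_v ⊆ M̂`. [folklore] -/
abbrev tubeSet (v : Fin 8) : Set (ClosedModel n (nbW hk hc hkn hε hε').W) := range (tubeEmb hk hc hkn hε hε' hcc' hc'ε v)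

/-- `isOpen_tubeSet` (isOpen tubeSet). [folklore] -/
theorem isOpen_tubeSet (v : Fin 8) : IsOpen (tubeSet hk hc hkn hε hε' hcc' hc'ε v) :=
  (isOpenEmbedding_tubeEmb hk hc hkn hε hε' hcc' hc'ε v).isOpen_range

/-- The thinner tube as the open tube of `SphereProductThomFundamentalClass`. [folklore] -/
def tbOpenTube : Tb k c' ≃ₜ ↥(SphereProd.openTube k c') where
  toFun y := ⟨y.1, y.2⟩
  invFun u := ⟨u.1, u.2⟩
  left_inv _ := rfl
  right_inv _ := rfl
  continuous_toFun := Continuous.subtype_mk continuous_subtype_val _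
  continuous_invFun := Continuous.subtype_mk continuous_subtype_val _

include hc' in
/-- **The tube set is homeomorphic to the interior of the model tube.** [folklore] -/
def tubeSetHomeo (v : Fin 8) :
    ↥(tubeSet hk hc hkn hε hε' hcc' hc'ε v) ≃ₜ ManifoldInterior n (SphereProd.Tube k n hkn hc') :=
  (isOpenEmbedding_tubeEmb hk hc hkn hε hε' hcc' hc'ε v).isEmbedding.toHomeomorph.symm.trans
    (tbOpenTube.trans (SphereProd.openTubeHomeomorph hc'))

/-- `tubeSetHomeo_tubeEmb` (tubeSetHomeo tubeEmb). [folklore] -/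
theorem tubeSetHomeo_tubeEmb (v : Fin 8) (y : Tb k c') :
    tubeSetHomeo hk hc hkn hε hε' hc' hcc' hc'ε v ⟨tubeEmb hk hc hkn hε hε' hcc' hc'ε v y, mem_range_self y⟩ =
      SphereProd.openTubeHomeomorph hc' (tbOpenTube y) := by
  change SphereProd.openTubeHomeomorph hc' (tbOpenTube
    ((isOpenEmbedding_tubeEmb hk hc hkn hε hε' hcc' hc'ε v).isEmbedding.toHomeomorph.symm
      ⟨tubeEmb hk hc hkn hε hε' hcc' hc'ε v y, mem_range_self y⟩)) = _
  rw [(isOpenEmbedding_tubeEmb hk hc hkn hε hε' hcc' hc'ε v).isEmbedding.toHomeomorph_symm_apply y]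

/-- **The Thom collapse of `M̂` onto the Thom space of the `v`-th tube.** [cite: Kosinski1993, VI.12] -/
def collapseV (v : Fin 8) : C(ClosedModel n (nbW hk hc hkn hε hε').W, SphereProd.ThomSp k n hkn hc') :=
  OnePoint.collapseCM (isOpen_tubeSet hk hc hkn hε hε' hcc' hc'ε v) (tubeSetHomeo hk hc hkn hε hε' hc' hcc' hc'ε v)

/-- **On the tube the collapse is the model collapse.** [folklore] -/
theorem collapseV_tubeEmb (v : Fin 8) (y : Tb k c') :
    collapseV hk hc hkn hε hε' hc' hcc' hc'ε v (tubeEmb hk hc hkn hε hε' hcc' hc'ε v y) =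
      SphereProd.tubeCollapse hc' (y : (𝕊 k) × (𝕊 k)) := by
  rw [collapseV, OnePoint.collapseCM_apply, OnePoint.collapse_apply_of_mem _ _ (mem_range_self y),
    tubeSetHomeo_tubeEmb]
  exact (SphereProd.tubeCollapse_coe hc' (tbOpenTube y)).symm

/-- Off the tube the collapse is `∞`. [folklore] -/
theorem collapseV_of_not_mem (v : Fin 8) {z : ClosedModel n (nbW hk hc hkn hε hε').W}
    (hz : z ∉ tubeSet hk hc hkn hε hε' hcc' hc'ε v) :
    collapseV hk hc hkn hε hε' hc' hcc' hc'ε v z = OnePoint.infty :=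
  OnePoint.collapse_apply_of_not_mem _ _ hz

/-- `tubeEmb v y = tubeEmb w y'` iff `ι v y = ι w y'`. [folklore] -/
theorem tubeEmb_eq_tubeEmb_iff {v w : Fin 8} {y y' : Tb k c'} :
    tubeEmb hk hc hkn hε hε' hcc' hc'ε v y = tubeEmb hk hc hkn hε hε' hcc' hc'ε w y' ↔
      ι hk hc hkn v (inclTb hcc' y) = ι hk hc hkn w (inclTb hcc' y') := by
  constructor
  · intro h
    exact intPt_injective hk hc hkn hε hε' (OnePoint.coe_injective h)
  · intro h
    simp only [tubeEmb, h]

end Tube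

/-! ### §3 The core spheres and the collapses -/

section Core

include hc'ε

/-- A diagonal point of the thinner tube. [folklore] -/
def diagPt' (p : 𝕊 k) : Tb k c' := diagPt (abs_lt.1 hc').2 p

include hc' in
/-- **The core sphere** of the `v`-th tube in the closed model `M̂`. [cite: Kosinski1993, VI.12 p. 120] -/
def coreS (v : Fin 8) : C(𝕊 k, ClosedModel n (nbW hk hc hkn hε hε').W) where
  toFun p := tubeEmb hk hc hkn hε hε' hcc' hc'ε v (diagPt' hc' p)
  continuous_toFun := (isOpenEmbedding_tubeEmb hk hc hkn hε hε' hcc' hc'ε v).continuous.comp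
    (Continuous.subtype_mk (continuous_id.prodMk continuous_id) _)

/-- **`collapseV v ∘ coreS v = ĉ ∘ diag`.** [folklore] -/
theorem collapseV_comp_coreS_self (v : Fin 8) :
    (collapseV hk hc hkn hε hε' hc' hcc' hc'ε v).comp (coreS hk hc hkn hε hε' hc' hcc' hc'ε v) =
      (SphereProd.tubeCollapse hc').comp (SphereProd.diagX k) := by
  ext p : 1
  exact collapseV_tubeEmb hk hc hkn hε hε' hc' hcc' hc'ε v _

omit hc'ε in
/-- The plumbing map sends the diagonal point `(p, p)` to the fibre point `(e, p)`. [folklore] -/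
theorem plumbMap_diag (e : 𝕊 k) {p : 𝕊 k} (h : -1 < ⟪(p : 𝔼 (k + 1)), (e : 𝔼 (k + 1))⟫) :
    plumbMap e (p, p) = (e, p) := by
  have he := norm_eq_of_mem_sphere e
  have hpe : ‖(p : 𝔼 (k + 1))‖ = ‖(e : 𝔼 (k + 1))‖ := by rw [norm_eq_of_mem_sphere, he]
  have h0 : (p : 𝔼 (k + 1)) + (e : 𝔼 (k + 1)) ≠ 0 := add_ne_zero_of_neg_one_lt_inner he h
  have h1 : plumbFst e (p, p) = e := Subtype.ext (rotTo_self hpe h0)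
  refine Prod.ext h1 (Subtype.ext ?_)
  change rotFrom ((plumbFst e (p, p) : 𝕊 k) : 𝔼 (k + 1)) e p = p
  rw [h1]
  conv_lhs => rw [← rotTo_self_self (p := (e : 𝔼 (k + 1))) (p : 𝔼 (k + 1))]
  exact rotFrom_rotTo _ _ _

/-- The slice map `p ↦ (e, p)` into `Sᵏ × Sᵏ`. [folklore] -/
def sliceS (e : 𝕊 k) : C(𝕊 k, (𝕊 k) × (𝕊 k)) := ⟨fun p => (e, p), by fun_prop⟩

/-- **For an edge `{v, w}`, `collapseV v ∘ coreS w = ĉ ∘ slice_{e_{vw}}`**: the core of `w` meets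
the `v`-th tube in the fibre disc over the crossing point. [cite: Kosinski1993, VI.12 p. 120] -/
theorem collapseV_comp_coreS_adj {v w : Fin 8} (hvw : kosinskiGamma8 v w = 1) :
    (collapseV hk hc hkn hε hε' hc' hcc' hc'ε v).comp (coreS hk hc hkn hε hε' hc' hcc' hc'ε w) =
      (SphereProd.tubeCollapse hc').comp (sliceS (pole k (ecol v w).val)) := by
  have hne : v ≠ w := by rintro rfl; rw [kosinskiGamma8_diag] at hvw; norm_num at hvw
  have hwv : kosinskiGamma8 w v = 1 := by rw [gamma8_comm]; exact hvw
  have hc'0 : 0 ≤ c' := hc.nonneg.trans hcc'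
  ext p : 1
  change collapseV hk hc hkn hε hε' hc' hcc' hc'ε v (tubeEmb hk hc hkn hε hε' hcc' hc'ε w (diagPt' hc' p)) =
    SphereProd.tubeCollapse hc' ((pole k (ecol v w).val, p) : (𝕊 k) × (𝕊 k))
  have hx : ((inclTb hcc' (diagPt' hc' p) : Tb k c) : (𝕊 k) × (𝕊 k)) = (p, p) := rfl
  by_cases hp : c' < ⟪(pole k (ecol v w).val : 𝔼 (k + 1)), (p : 𝔼 (k + 1))⟫
  · -- the fibre point `(e, p)` lies in the thinner `v`-tube, and `ι w (p, p) = ι v (e, p)`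
    have hp' : c' < fibHt ((pole k (ecol v w).val, p) : (𝕊 k) × (𝕊 k)) := by rw [fibHt_apply]; exact hp
    let y : Tb k c' := ⟨(pole k (ecol v w).val, p), hp'⟩
    have hdom : ((inclTb hcc' (diagPt' hc' p) : Tb k c) : (𝕊 k) × (𝕊 k)) ∈ dom k c (ecol w v) := by
      rw [hx, ecol_comm, mem_dom, baseHt_apply, fibHt_apply]
      refine ⟨?_, ?_⟩
      · change c < ⟪(p : 𝔼 (k + 1)), (pole k (ecol v w).val : 𝔼 (k + 1))⟫
        rw [real_inner_comm]; exact hcc'.trans_lt hp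
      · change c < ⟪(p : 𝔼 (k + 1)), (p : 𝔼 (k + 1))⟫
        rw [real_inner_self_eq_norm_sq, norm_eq_of_mem_sphere, one_pow]; exact hc.lt_one
    have hpm : pm hc (ecol w v) (inclTb hcc' (diagPt' hc' p)) = inclTb hcc' y := by
      apply Subtype.ext
      rw [coe_pm_of_mem hc hdom, hx]
      change plumbMap (pole k (ecol w v).val) (p, p) = (pole k (ecol v w).val, p)
      rw [ecol_comm]
      refine plumbMap_diag (pole k (ecol v w).val) ?_
      have : (0 : ℝ) ≤ ⟪(pole k (ecol v w).val : 𝔼 (k + 1)), (p : 𝔼 (k + 1))⟫ := hc'0.trans hp.le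
      rw [real_inner_comm]; linarith
    have heq : tubeEmb hk hc hkn hε hε' hcc' hc'ε w (diagPt' hc' p) = tubeEmb hk hc hkn hε hε' hcc' hc'ε v y := by
      rw [tubeEmb_eq_tubeEmb_iff, ← ι_pm hk hc hkn w v hwv hdom, hpm]
    rw [heq, collapseV_tubeEmb]
  · -- otherwise both sides are `∞`
    have hR : SphereProd.tubeCollapse (hkn := hkn) hc' ((pole k (ecol v w).val, p) : (𝕊 k) × (𝕊 k)) = OnePoint.infty :=
      SphereProd.tubeCollapse_of_not_mem hc' hp
    rw [hR]
    apply collapseV_of_not_mem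
    rintro ⟨y, hy⟩
    rw [tubeEmb_eq_tubeEmb_iff] at hy
    -- `ι v y = ι w (p, p)` forces `pm y = (p, p)`, whose base height `⟪p, e⟫` is the fibre height of `y`
    rcases (ι_eq_ι_iff hk hc hkn).1 hy with ⟨h1, -⟩ | ⟨-, hdom, hpm⟩
    · exact hne h1
    · have h3 := congrArg (fun x : Tb k c => baseHt (pole k (ecol v w).val) (x : (𝕊 k) × (𝕊 k))) hpm
      have hb1 : -1 < baseHt (pole k (ecol v w).val) ((inclTb hcc' y : Tb k c) : (𝕊 k) × (𝕊 k)) := by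
        linarith [hdom.1, hc.nonneg]
      simp only [coe_pm_of_mem hc hdom] at h3
      rw [baseHt_plumbMap _ hb1, hx, baseHt_apply] at h3
      have hy2 : c' < fibHt (y : (𝕊 k) × (𝕊 k)) := y.2
      have h5 : fibHt ((inclTb hcc' y : Tb k c) : (𝕊 k) × (𝕊 k)) = fibHt (y : (𝕊 k) × (𝕊 k)) := rfl
      rw [h5] at h3
      change ⟪(p : 𝔼 (k + 1)), (pole k (ecol v w).val : 𝔼 (k + 1))⟫ = fibHt (y : (𝕊 k) × (𝕊 k)) at h3
      rw [← h3, real_inner_comm] at hy2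
      exact hp hy2

end Core

/-! ### §4 The pushed fundamental class has generating local classes off `∞` -/

section LocalGen

include hc'ε

/-- Every finite point of the Thom space is the collapse of a point of the tube. [folklore] -/
theorem exists_eq_collapseV_tubeEmb (v : Fin 8) (x : ↥(SphereProd.thomFinite k n hkn hc')) :
    ∃ y : Tb k c', (x : SphereProd.ThomSp k n hkn hc') = collapseV hk hc hkn hε hε' hc' hcc' hc'ε v (tubeEmb hk hc hkn hε hε' hcc' hc'ε v y) := by
  obtain ⟨xf, hxf⟩ := OnePoint.ne_infty_iff_exists.1 x.2
  -- `xf = openTubeHomeomorph u`, `u = tbOpenTube y`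
  set u : ↥(SphereProd.openTube k c') := (SphereProd.openTubeHomeomorph hc').symm xf with hu
  refine ⟨tbOpenTube.symm u, ?_⟩
  rw [collapseV_tubeEmb, SphereProd.tubeCollapse_coe hc', ← hxf]
  change (xf : SphereProd.ThomSp k n hkn hc') =
    ((SphereProd.openTubeHomeomorph (hkn := hkn) hc' (tbOpenTube (tbOpenTube.symm u)) :
      ManifoldInterior n (SphereProd.Tube k n hkn hc')) : SphereProd.ThomSp k n hkn hc')
  rw [Homeomorph.apply_symm_apply, hu, Homeomorph.apply_symm_apply]

/-- **The pushed class `(collapseV v)_* ẑ` restricts to generators at all finite points of the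
Thom space** (`ẑ` the closed-model class of a relative fundamental class `z` of `M(4m)`).
[cite: KervaireMilnorAnnals1963, §7, footnote pp. 528–529] -/
theorem isGenerator_toLocal_map_collapseV (hn : 1 ≤ n)
    {z : relativeSingularHomology ℤ ℤ (nbW hk hc hkn hε hε').W ((𝓡∂ (n + 1)).boundary (nbW hk hc hkn hε hε').W) (n + 1)}
    (hz : IsRelFundamentalClass ℤ ((𝓡∂ (n + 1)).boundary (nbW hk hc hkn hε hε').W) z) (v : Fin 8)
    (x : ↥(SphereProd.thomFinite k n hkn hc')) :
    ∃ e : localHomology ℤ ℤ (SphereProd.ThomSp k n hkn hc') (x : SphereProd.ThomSp k n hkn hc') (n + 1) ≃ₗ[ℤ] ℤ,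
      e (singularHomology.toLocal ℤ ℤ (x : SphereProd.ThomSp k n hkn hc') (n + 1)
        (singularHomology.map ℤ ℤ (collapseV hk hc hkn hε hε' hc' hcc' hc'ε v) (n + 1)
          ((nbW hk hc hkn hε hε').closedModelClass ℤ ℤ hn z))) = 1 := by
  obtain ⟨y, hy⟩ := exists_eq_collapseV_tubeEmb hk hc hkn hε hε' hc' hcc' hc'ε v x
  -- the point `q = tubeEmb v y` of the tube set and the target point
  set G := tubeSet hk hc hkn hε hε' hcc' hc'ε v with hG
  set φ := tubeSetHomeo hk hc hkn hε hε' hc' hcc' hc'ε v with hφ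
  let x₀ : ↥G := ⟨tubeEmb hk hc hkn hε hε' hcc' hc'ε v y, mem_range_self y⟩
  have hx₀ : ((φ x₀ : ManifoldInterior n (SphereProd.Tube k n hkn hc')) : SphereProd.ThomSp k n hkn hc') =
      (x : SphereProd.ThomSp k n hkn hc') := by
    rw [hy]; exact (OnePoint.collapse_apply_of_mem G φ x₀.2).symm
  -- it suffices to treat the point `φ x₀`
  suffices h : ∃ e : localHomology ℤ ℤ (SphereProd.ThomSp k n hkn hc')
      ((φ x₀ : ManifoldInterior n (SphereProd.Tube k n hkn hc')) : SphereProd.ThomSp k n hkn hc') (n + 1) ≃ₗ[ℤ] ℤ,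
      e (singularHomology.toLocal ℤ ℤ ((φ x₀ : ManifoldInterior n (SphereProd.Tube k n hkn hc')) : SphereProd.ThomSp k n hkn hc') (n + 1)
        (singularHomology.map ℤ ℤ (collapseV hk hc hkn hε hε' hc' hcc' hc'ε v) (n + 1)
          ((nbW hk hc hkn hε hε').closedModelClass ℤ ℤ hn z))) = 1 by
    rw [hx₀] at h; exact h
  -- naturality of `toLocal` along the collapse
  have hmaps := OnePoint.mapsTo_collapse_compl_singleton φ.injective x₀
  have hnat := relativeSingularHomology.ofAbsolute_comp_map ℤ ℤ
    (collapseV hk hc hkn hε hε' hc' hcc' hc'ε v) hmaps (n + 1)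
  have key : singularHomology.toLocal ℤ ℤ ((φ x₀ : ManifoldInterior n (SphereProd.Tube k n hkn hc')) : SphereProd.ThomSp k n hkn hc') (n + 1)
      (singularHomology.map ℤ ℤ (collapseV hk hc hkn hε hε' hc' hcc' hc'ε v) (n + 1)
        ((nbW hk hc hkn hε hε').closedModelClass ℤ ℤ hn z)) =
      relativeSingularHomology.map ℤ ℤ (collapseV hk hc hkn hε hε' hc' hcc' hc'ε v) hmaps (n + 1)
        (singularHomology.toLocal ℤ ℤ (x₀ : ClosedModel n (nbW hk hc hkn hε hε').W) (n + 1)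
          ((nbW hk hc hkn hε hε').closedModelClass ℤ ℤ hn z)) := by
    have := congrArg (fun f => f ((nbW hk hc hkn hε hε').closedModelClass ℤ ℤ hn z)) hnat
    simp only [ModuleCat.comp_apply] at this
    exact this.symm
  rw [key]
  haveI : IsIso (relativeSingularHomology.map ℤ ℤ (collapseV hk hc hkn hε hε' hc' hcc' hc'ε v) hmaps (n + 1)) :=
    OnePoint.isIso_map_collapse_local ℤ ℤ (isOpen_tubeSet hk hc hkn hε hε' hcc' hc'ε v) φ x₀ (n + 1)
  refine (exists_linearEquiv_apply_eq_one_iff_of_isIso _ _).2 ?_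
  -- the local class of `ẑ` at the interior point `x₀ = q(ι v y)`
  let w := intPt hk hc hkn hε hε' (ι hk hc hkn v (inclTb hcc' y)) (rho_ι_inclTb_lt hk hc hkn hcc' hc'ε v y)
  have h := (nbW hk hc hkn hε hε').isGenerator_toLocal_closedModelClass_of_mem_interior ℤ hn hz w.2
  rw [boundaryCollapse_of_mem_interior w.2] at h
  exact h

end LocalGen

/-! ### §5 Classes pulled back from the Thom space are supported on the core -/

section Support

include hc'ε

include hc' in
/-- **The core set** `Σ_v = coreS v (Sᵏ) ⊆ M̂`. [folklore] -/
abbrev coreSet (v : Fin 8) : Set (ClosedModel n (nbW hk hc hkn hε hε').W) := range (coreS hk hc hkn hε hε' hc' hcc' hc'ε v)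

/-- The core set is closed (compact). [folklore] -/
theorem isClosed_coreSet (v : Fin 8) : IsClosed (coreSet hk hc hkn hε hε' hc' hcc' hc'ε v) :=
  (isCompact_range (coreS hk hc hkn hε hε' hc' hcc' hc'ε v).continuous).isClosed

/-- The core set lies in the tube set. [folklore] -/
theorem coreSet_subset_tubeSet (v : Fin 8) :
    coreSet hk hc hkn hε hε' hc' hcc' hc'ε v ⊆ tubeSet hk hc hkn hε hε' hcc' hc'ε v := by
  rintro _ ⟨p, rfl⟩; exact ⟨_, rfl⟩

/-- Off the core set the collapse avoids the image of the diagonal. [folklore] -/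
theorem collapseV_not_mem_thomDiag (v : Fin 8) {zz : ClosedModel n (nbW hk hc hkn hε hε').W}
    (hzz : zz ∉ coreSet hk hc hkn hε hε' hc' hcc' hc'ε v) :
    collapseV hk hc hkn hε hε' hc' hcc' hc'ε v zz ∉ SphereProd.thomDiag (SphereProd.openTubeHomeomorph (hkn := hkn) hc') := by
  rintro ⟨u, hu, hEq⟩
  by_cases hmem : zz ∈ tubeSet hk hc hkn hε hε' hcc' hc'ε v
  · obtain ⟨y, rfl⟩ := hmem
    rw [collapseV_tubeEmb, SphereProd.tubeCollapse_coe hc'] at hEq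
    -- `thomIncl` is injective, so `u = tbOpenTube y` is a diagonal point
    have huy : u = tbOpenTube y :=
      (SphereProd.openTubeHomeomorph hc').injective (OnePoint.coe_injective hEq)
    have hdiag : (y : (𝕊 k) × (𝕊 k)).1 = (y : (𝕊 k) × (𝕊 k)).2 := by
      have : ((u : (𝕊 k) × (𝕊 k))) ∈ SphereProd.diagonal k := hu
      rw [huy] at this; exact this
    apply hzz
    refine ⟨(y : (𝕊 k) × (𝕊 k)).1, ?_⟩
    change tubeEmb hk hc hkn hε hε' hcc' hc'ε v (diagPt' hc' (y : (𝕊 k) × (𝕊 k)).1) = tubeEmb hk hc hkn hε hε' hcc' hc'ε v y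
    congr 1
    apply Subtype.ext
    exact Prod.ext rfl hdiag
  · rw [collapseV_of_not_mem hk hc hkn hε hε' hc' hcc' hc'ε v hmem] at hEq
    exact OnePoint.coe_ne_infty _ hEq

/-- **A class pulled back from the Thom space which vanishes off the image of the diagonal vanishes
off the core sphere.** [cite: MilnorStasheff1974, §11 Problem 11-C] -/
theorem map_compl_coreSet_eq_zero (v : Fin 8) {j : ℕ}
    {ξ : singularCohomology ℤ ℤ (SphereProd.ThomSp k n hkn hc') j}
    (hξB : singularCohomology.map ℤ ℤ (subsetIncl (SphereProd.thomDiag (SphereProd.openTubeHomeomorph (hkn := hkn) hc'))ᶜ) j ξ = 0) :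
    singularCohomology.map ℤ ℤ (subsetIncl (coreSet hk hc hkn hε hε' hc' hcc' hc'ε v)ᶜ) j
      (singularCohomology.map ℤ ℤ (collapseV hk hc hkn hε hε' hc' hcc' hc'ε v) j ξ) = 0 := by
  let g : C(↥(coreSet hk hc hkn hε hε' hc' hcc' hc'ε v)ᶜ, ↥(SphereProd.thomDiag (SphereProd.openTubeHomeomorph (hkn := hkn) hc'))ᶜ) :=
    ⟨fun zz => ⟨collapseV hk hc hkn hε hε' hc' hcc' hc'ε v zz.1, collapseV_not_mem_thomDiag hk hc hkn hε hε' hc' hcc' hc'ε v zz.2⟩,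
      by fun_prop⟩
  have hfac : (collapseV hk hc hkn hε hε' hc' hcc' hc'ε v).comp (subsetIncl (coreSet hk hc hkn hε hε' hc' hcc' hc'ε v)ᶜ) =
      (subsetIncl (SphereProd.thomDiag (SphereProd.openTubeHomeomorph (hkn := hkn) hc'))ᶜ).comp g := by
    ext zz : 1; rfl
  rw [← ModuleCat.comp_apply, ← singularCohomology.map_comp, hfac, singularCohomology.map_comp,
    ModuleCat.comp_apply, hξB, map_zero]

end Support

/-! ### §6 `Hₖ` of the tube is generated by the core class -/

section CoreClass

include hc'ε

include hc' in
/-- The core sphere as a map into the tube set. [folklore] -/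
def coreT (v : Fin 8) : C(𝕊 k, ↥(tubeSet hk hc hkn hε hε' hcc' hc'ε v)) where
  toFun p := ⟨coreS hk hc hkn hε hε' hc' hcc' hc'ε v p, coreSet_subset_tubeSet hk hc hkn hε hε' hc' hcc' hc'ε v ⟨p, rfl⟩⟩
  continuous_toFun := (coreS hk hc hkn hε hε' hc' hcc' hc'ε v).continuous.subtype_mk _

/-- `subsetIncl ∘ coreT = coreS`. [folklore] -/
theorem subsetIncl_comp_coreT (v : Fin 8) :
    (subsetIncl (tubeSet hk hc hkn hε hε' hcc' hc'ε v)).comp (coreT hk hc hkn hε hε' hc' hcc' hc'ε v) =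
      coreS hk hc hkn hε hε' hc' hcc' hc'ε v := by
  ext p : 1; rfl

omit hc'ε in
/-- The whole thinner tube is the piece `T_v(2)` (`ρ̂ ≤ 1 < 2`). [folklore] -/
theorem pieceT_two_eq_univ (hc'P : IsParam c') (v : Fin 8) : pieceT k c' v 2 = univ :=
  eq_univ_of_forall fun x => by
    change rhoHat k c' v (x : (𝕊 k) × (𝕊 k)) < 2
    have := (rhoHat_le_bFn hc'P v (x : (𝕊 k) × (𝕊 k))).trans (bFn_le_one _)
    linarith

include hk hc' in
/-- **The tube set is homotopy equivalent to `Sᵏ`**, with homotopy inverse the core sphere.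
[cite: Kosinski1993, VI.(11.5)] -/
def tubeSetHomotopyEquiv (hc'P : IsParam c') (v : Fin 8) :
    ContinuousMap.HomotopyEquiv ↥(tubeSet hk hc hkn hε hε' hcc' hc'ε v) (𝕊 k) :=
  ((isOpenEmbedding_tubeEmb hk hc hkn hε hε' hcc' hc'ε v).isEmbedding.toHomeomorph.symm.toHomotopyEquiv.trans
    (((Homeomorph.Set.univ (Tb k c')).symm.trans (Homeomorph.setCongr (pieceT_two_eq_univ hc'P v).symm)).toHomotopyEquiv)).trans
    (pieceTHomotopyEquiv hk hc'P v two_pos)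

/-- The homotopy inverse of `tubeSetHomotopyEquiv` is the core sphere. [folklore] -/
theorem tubeSetHomotopyEquiv_invFun (hc'P : IsParam c') (v : Fin 8) :
    (tubeSetHomotopyEquiv hk hc hkn hε hε' hcc' hc'ε hc'P v).invFun = coreT hk hc hkn hε hε' hc' hcc' hc'ε v := by
  ext p : 1
  apply Subtype.ext
  rfl

include hk hc' in
/-- **`Hₖ` of the tube set is generated by the core class** `(coreT v)_* [Sᵏ]`. [cite: Kosinski1993, VI.(11.5)] -/
theorem exists_eq_smul_coreT (hc'P : IsParam c') (v : Fin 8)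
    (yy : singularHomology ℤ ℤ ↥(tubeSet hk hc hkn hε hε' hcc' hc'ε v) k) :
    ∃ m : ℤ, yy = m • singularHomology.map ℤ ℤ (coreT hk hc hkn hε hε' hc' hcc' hc'ε v) k (SphereProd.μS hk).fundamentalClass := by
  set E := tubeSetHomotopyEquiv hk hc hkn hε hε' hcc' hc'ε hc'P v with hE
  obtain ⟨m, hm⟩ := SphereProd.exists_eq_smul_fundamentalClass_sphere hk (singularHomology.map ℤ ℤ E.toFun k yy)
  refine ⟨m, ?_⟩
  have h1 : singularHomology.map ℤ ℤ E.invFun k (singularHomology.map ℤ ℤ E.toFun k yy) = yy := by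
    rw [← ModuleCat.comp_apply, ← singularHomology.map_comp, singularHomology.map_eq_of_homotopic ℤ ℤ E.left_inv,
      singularHomology.map_id, ModuleCat.id_apply]
  rw [← h1, hm, map_zsmul, ← tubeSetHomotopyEquiv_invFun hk hc hkn hε hε' hc' hcc' hc'ε hc'P v]

end CoreClass

end Plumbing

end Literature.Topology.FourManifolds
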